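import Mathlib
import Summits.ValiantsHypothesis.ValiantsHypothesis.Theorems.NewtonTauWeak.Negative.Zonogon
import Summits.ValiantsHypothesis.ValiantsHypothesis.Theorems.NewtonUnitEquationsNewtonTauWeakResidueDesignT2
import Summits.ValiantsHypothesis.ValiantsHypothesis.Theorems.NewtonUnitEquationsNewtonTauWeakMultiGradedQuasi

/-!
# `NewtonUnitEquationsNewtonTauWeakMultiGradedDesign` — designs of multiplicative rank `s`: support theorem, T2-quasi, kill switch

Line `binomial-normal-form` of crux `NewtonTauWeak` (stmt-ValiantsHypothesis-5904), QUASI rung, multiplicative rank `s`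
(registered stubs `multiGradedDesignT2_quasi`, `multiLevelSet_of_T2`).

Setting.  A dissociated exponent list `d j ∈ ℕ²` (`j : Fin N`), VECTOR grades `g j : Fin s → ℕ`, a modulus `q ≥ 1`
with a primitive `q`-th root of unity `ζ`, residues `r : Fin s → ℕ`, nonzero coefficients `ρ j`.  The *multi-graded
(rank-`s`) isolating design* is the sum of `q^s` products of `N` binomials
`F = Σ_{θ : Fin s → Fin q} c_θ Π_j (1 − (Π_i ζ^{θ_i g_{ji}}) ρ_j X^{d_j})`, `c_θ = Π_i ζ^{−θ_i r_i} / q`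
— its coefficient matrix `ρ_{θ j} = Π_i (ζ^{θ_i})^{g_{ji}} ρ_j` has multiplicative rank `s`.

* (`MultiGradedDesignAux.coeff_multi_subsetSum`)  By character orthogonality in each coordinate
  (`ResidueDesignT2Aux.charSum_eq`) the coefficient of `F` at `Σ_{j∈J} d_j` is
  `Π_{j∈J} (−ρ_j) · [∀ i, Σ_{j∈J} g_{ji} ≡ r_i (mod q)]`.
* (`MultiGradedDesignAux.support_multi_design`)  Hence `supp F` is EXACTLY the multi-residue level set
  `{Σ_J d : ∀ i, Σ_J g_{·i} ≡ r_i (mod q)}`, and for `q = cN + 1 >` all grade sums it is the exact multi-level set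
  `X_v = {Σ_J d : Σ_J g = v}` (`MultiGradedDesignAux.filter_mod_eq_filter_eq`).
* (`multiGradedDesignT2_quasi`)  With THEOREM W-multi-quasi (`multiLevelSetHull_quasi`): `vert F ≤ 2 (2 (cN + 1)^s)^k + 2`
  for `N ≤ 2^k` — the stub's inequality holds on rank-`s` isolating designs up to the quasi-polynomial factor
  `N^{O(s log (cN))}` (`K = (cN+1)^s` products).
* (`multiLevelSet_of_T2`, KILL SWITCH for rank `s`)  Conversely, if the open stub `stub_binomialNewtonTauCommon` holds with
  exponent `b`, then EVERY multi-level set `X_v` on a dissociated list has at most `((cN + 1)^s · N + 2)^b` hull vertices: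
  a super-polynomial rank-`s` family refutes T2 (and KPTT Conj. 1 in print), exactly as `levelSet_of_T2` does at rank one.

Folklore (character orthogonality, expansion of binomial products); no named facts, no citations, no `def`s.
-/

-- Sub = Summit single-conjunct layout: the duplicated namespace component is mandated by the tree.
set_option linter.dupNamespace false

noncomputable section

open scoped BigOperators
open MvPolynomial
open Summit.ValiantsHypothesis.ValiantsHypothesis.Theorems.NewtonTauWeak.Negative (vert)

namespace Summit.ValiantsHypothesis.ValiantsHypothesis.Theorems.NewtonUnitEquationsNewtonTauWeak

namespace MultiGradedDesignAux

/-- Regrouping of the coefficient of one expanded product by coordinates: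
`Π_{j ∈ J} (−(Π_i ζ^{θ_i g_{ji}}) ρ_j) = Π_{j ∈ J} (−ρ_j) · Π_i ζ^{θ_i · Σ_{j∈J} g_{ji}}`. [folklore] -/
theorem prod_neg_charpow_mul {N s q : ℕ} (g : Fin N → Fin s → ℕ) (ζ : ℂ) (ρ : Fin N → ℂ) (θ : Fin s → Fin q)
    (J : Finset (Fin N)) :
    ∏ j ∈ J, -((∏ i, ζ ^ ((θ i : ℕ) * g j i)) * ρ j) =
      (∏ j ∈ J, -ρ j) * ∏ i, ζ ^ ((θ i : ℕ) * ∑ j ∈ J, g j i) := by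
  have h : ∀ j, -((∏ i, ζ ^ ((θ i : ℕ) * g j i)) * ρ j) = (-ρ j) * ∏ i, ζ ^ ((θ i : ℕ) * g j i) :=
    fun j => by ring
  simp_rw [h]
  rw [Finset.prod_mul_distrib, Finset.prod_comm]
  congr 1
  refine Finset.prod_congr rfl fun i _ => ?_
  rw [Finset.prod_pow_eq_pow_sum, Finset.mul_sum]

/-- Coefficients of the multi-graded design, raw form: expanding every product,
`coeff_e F = Σ_θ Σ_{T : Σ_T d = e} c_θ Π_{j ∈ T} (−(Π_i ζ^{θ_i g_{ji}}) ρ_j)`. [folklore] -/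
theorem coeff_multi {N s q : ℕ} (g : Fin N → Fin s → ℕ) (r : Fin s → ℕ) (ζ : ℂ) (ρ : Fin N → ℂ)
    (d : Fin N → (Fin 2 →₀ ℕ)) (e : Fin 2 →₀ ℕ) :
    coeff e (∑ θ : Fin s → Fin q, C (∏ i, ζ⁻¹ ^ ((θ i : ℕ) * r i) / (q : ℂ)) *
        ∏ j, (1 - C ((∏ i, ζ ^ ((θ i : ℕ) * g j i)) * ρ j) * monomial (d j) 1)) =
      ∑ θ : Fin s → Fin q, ∑ T : Finset (Fin N),
        if ∑ j ∈ T, d j = e then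
          (∏ i, ζ⁻¹ ^ ((θ i : ℕ) * r i) / (q : ℂ)) * ∏ j ∈ T, -((∏ i, ζ ^ ((θ i : ℕ) * g j i)) * ρ j)
        else 0 := by
  rw [coeff_sum]
  refine Finset.sum_congr rfl fun θ _ => ?_
  rw [ResidueDesignT2Aux.prod_one_sub_eq_sum, Finset.mul_sum, coeff_sum]
  refine Finset.sum_congr rfl fun T _ => ?_
  rw [C_mul_monomial, coeff_monomial]

/-- **Coefficient formula on a dissociated frame.**  At the subset sum `Σ_J d` only `T = J` contributes; after
regrouping by coordinates the `θ`-sum factors into character sums (`ResidueDesignT2Aux.charSum_eq`), giving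
`coeff_{Σ_J d} F = Π_{j ∈ J} (−ρ_j) · [∀ i, Σ_{j∈J} g_{ji} ≡ r_i (mod q)]`. [folklore] -/
theorem coeff_multi_subsetSum {N s q : ℕ} (hq : 1 ≤ q) (ζ : ℂ) (hζ : IsPrimitiveRoot ζ q)
    (g : Fin N → Fin s → ℕ) (r : Fin s → ℕ) (ρ : Fin N → ℂ) (d : Fin N → (Fin 2 →₀ ℕ))
    (hdis : ∀ J J' : Finset (Fin N), ∑ j ∈ J, d j = ∑ j ∈ J', d j → J = J') (J : Finset (Fin N)) :
    coeff (∑ j ∈ J, d j) (∑ θ : Fin s → Fin q, C (∏ i, ζ⁻¹ ^ ((θ i : ℕ) * r i) / (q : ℂ)) *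
        ∏ j, (1 - C ((∏ i, ζ ^ ((θ i : ℕ) * g j i)) * ρ j) * monomial (d j) 1)) =
      (∏ j ∈ J, -ρ j) * if ∀ i, (∑ j ∈ J, g j i) % q = r i % q then 1 else 0 := by
  rw [coeff_multi]
  calc (∑ θ : Fin s → Fin q, ∑ T : Finset (Fin N),
        if ∑ j ∈ T, d j = ∑ j ∈ J, d j then
          (∏ i, ζ⁻¹ ^ ((θ i : ℕ) * r i) / (q : ℂ)) * ∏ j ∈ T, -((∏ i, ζ ^ ((θ i : ℕ) * g j i)) * ρ j)
        else 0)
      = ∑ θ : Fin s → Fin q, (∏ i, ζ⁻¹ ^ ((θ i : ℕ) * r i) / (q : ℂ)) *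
          ((∏ j ∈ J, -ρ j) * ∏ i, ζ ^ ((θ i : ℕ) * ∑ j ∈ J, g j i)) := by
        refine Finset.sum_congr rfl fun θ _ => ?_
        rw [Finset.sum_eq_single J (fun T _ hTJ => if_neg fun h => hTJ (hdis T J h))
          (fun h => absurd (Finset.mem_univ J) h), if_pos rfl, prod_neg_charpow_mul]
    _ = (∏ j ∈ J, -ρ j) * ∑ θ : Fin s → Fin q,
          ∏ i, (ζ⁻¹ ^ ((θ i : ℕ) * r i) / (q : ℂ) * ζ ^ ((θ i : ℕ) * ∑ j ∈ J, g j i)) := by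
        rw [Finset.mul_sum]
        refine Finset.sum_congr rfl fun θ _ => ?_
        rw [mul_left_comm, Finset.prod_mul_distrib]
    _ = (∏ j ∈ J, -ρ j) * ∏ i, ∑ t : Fin q,
          (ζ⁻¹ ^ ((t : ℕ) * r i) / (q : ℂ) * ζ ^ ((t : ℕ) * ∑ j ∈ J, g j i)) := by
        rw [Fintype.prod_sum fun i (t : Fin q) => ζ⁻¹ ^ ((t : ℕ) * r i) / (q : ℂ) * ζ ^ ((t : ℕ) * ∑ j ∈ J, g j i)]
    _ = (∏ j ∈ J, -ρ j) * ∏ i, (if (∑ j ∈ J, g j i) % q = r i % q then (1 : ℂ) else 0) := by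
        congr 1
        exact Finset.prod_congr rfl fun i _ => ResidueDesignT2Aux.charSum_eq q hq ζ hζ _ (r i)
    _ = (∏ j ∈ J, -ρ j) * if ∀ i, (∑ j ∈ J, g j i) % q = r i % q then 1 else 0 := by
        rw [Fintype.prod_boole]
        split_ifs <;> rfl

/-- **Support of the multi-graded design** = the multi-residue level set
`{Σ_J d : ∀ i, Σ_{j∈J} g_{ji} ≡ r_i (mod q)}`: off the subset sums every raw summand vanishes, and at a subset sum the
coefficient is `Π_{j∈J} (−ρ_j) ≠ 0` times the admissibility indicator. [folklore] -/
theorem support_multi_design {N s q : ℕ} (hq : 1 ≤ q) (ζ : ℂ) (hζ : IsPrimitiveRoot ζ q)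
    (g : Fin N → Fin s → ℕ) (r : Fin s → ℕ) (ρ : Fin N → ℂ) (hρ : ∀ j, ρ j ≠ 0) (d : Fin N → (Fin 2 →₀ ℕ))
    (hdis : ∀ J J' : Finset (Fin N), ∑ j ∈ J, d j = ∑ j ∈ J', d j → J = J') :
    (∑ θ : Fin s → Fin q, C (∏ i, ζ⁻¹ ^ ((θ i : ℕ) * r i) / (q : ℂ)) *
        ∏ j, (1 - C ((∏ i, ζ ^ ((θ i : ℕ) * g j i)) * ρ j) * monomial (d j) 1)).support =
      ((Finset.univ.filter fun J : Finset (Fin N) => ∀ i, (∑ j ∈ J, g j i) % q = r i % q).image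
        fun J => ∑ j ∈ J, d j : Finset (Fin 2 →₀ ℕ)) := by
  have hprod : ∀ J : Finset (Fin N), ∏ j ∈ J, -ρ j ≠ 0 := fun J =>
    Finset.prod_ne_zero_iff.mpr fun j _ => neg_ne_zero.mpr (hρ j)
  ext e
  rw [mem_support_iff, Finset.mem_image]
  constructor
  · intro he
    by_cases hex : ∃ J : Finset (Fin N), ∑ j ∈ J, d j = e
    · obtain ⟨J, rfl⟩ := hex
      rw [coeff_multi_subsetSum hq ζ hζ g r ρ d hdis J] at he
      refine ⟨J, Finset.mem_filter.mpr ⟨Finset.mem_univ J, ?_⟩, rfl⟩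
      by_contra hJ
      exact he (by rw [if_neg hJ, mul_zero])
    · refine absurd ?_ he
      rw [coeff_multi]
      refine Finset.sum_eq_zero fun θ _ => Finset.sum_eq_zero fun T _ => if_neg fun hT => hex ⟨T, hT⟩
  · rintro ⟨J, hJ, rfl⟩
    rw [coeff_multi_subsetSum hq ζ hζ g r ρ d hdis J, if_pos (Finset.mem_filter.mp hJ).2, mul_one]
    exact hprod J

/-- **Exact levels below the modulus.**  If all grade components are `≤ c` and `v ≤ cN` componentwise, then for
`q = cN + 1` the multi-residue condition `∀ i, Σ_J g_{·i} ≡ v_i (mod q)` is the exact level condition `Σ_J g = v`.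
[folklore] -/
theorem filter_mod_eq_filter_eq {N s c : ℕ} (g : Fin N → Fin s → ℕ) (hgc : ∀ j i, g j i ≤ c) (v : Fin s → ℕ)
    (hv : ∀ i, v i ≤ c * N) :
    (Finset.univ.filter fun J : Finset (Fin N) => ∀ i, (∑ j ∈ J, g j i) % (c * N + 1) = v i % (c * N + 1)) =
      Finset.univ.filter fun J : Finset (Fin N) => ∑ j ∈ J, g j = v := by
  refine Finset.filter_congr fun J _ => ?_
  have hle : ∀ i, ∑ j ∈ J, g j i ≤ c * N := fun i =>
    calc ∑ j ∈ J, g j i ≤ ∑ j, g j i := Finset.sum_le_sum_of_subset (Finset.subset_univ J)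
      _ ≤ ∑ _j : Fin N, c := Finset.sum_le_sum fun j _ => hgc j i
      _ = c * N := by rw [Finset.sum_const, Finset.card_univ, Fintype.card_fin, smul_eq_mul, Nat.mul_comm]
  rw [funext_iff]
  refine forall_congr' fun i => ?_
  rw [Finset.sum_apply, Nat.mod_eq_of_lt (Nat.lt_succ_of_le (hle i)), Nat.mod_eq_of_lt (Nat.lt_succ_of_le (hv i))]

end MultiGradedDesignAux

/-- **T2 on rank-`s` isolating designs up to a quasi-polynomial factor, registered stub `multiGradedDesignT2_quasi`.**
On a dissociated exponent list `d` with nonzero `ρ j`, vector grades `g j : Fin s → ℕ` (nonzero, components `≤ c`),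
a level `v ≤ cN` (componentwise), `N ≤ 2^k`, and a primitive `(cN+1)`-th root of unity `ζ`, the design
`Σ_{θ : Fin s → Fin (cN+1)} c_θ Π_j (1 − (Π_i ζ^{θ_i g_{ji}}) ρ_j X^{d_j})` (`c_θ = Π_i ζ^{−θ_i v_i}/(cN+1)`; `(cN+1)^s`
products, multiplicative rank `s`) has at most `2 (2 (cN + 1)^s)^k + 2` Newton vertices: its support is exactly the
multi-level set `X_v` (`MultiGradedDesignAux.support_multi_design`, `…filter_mod_eq_filter_eq`), bounded by
`multiLevelSetHull_quasi`. [folklore] -/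
theorem multiGradedDesignT2_quasi (s k N c : ℕ) (hN : N ≤ 2 ^ k) (g : Fin N → Fin s → ℕ) (hg0 : ∀ j, g j ≠ 0)
    (hgc : ∀ j i, g j i ≤ c) (v : Fin s → ℕ) (hv : ∀ i, v i ≤ c * N) (ζ : ℂ)
    (hζ : IsPrimitiveRoot ζ (c * N + 1)) (ρ : Fin N → ℂ) (hρ : ∀ j, ρ j ≠ 0) (d : Fin N → (Fin 2 →₀ ℕ))
    (hdis : ∀ J J' : Finset (Fin N), ∑ j ∈ J, d j = ∑ j ∈ J', d j → J = J') :
    vert (∑ θ : Fin s → Fin (c * N + 1), C (∏ i, ζ⁻¹ ^ ((θ i : ℕ) * v i) / ((c * N + 1 : ℕ) : ℂ)) *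
        ∏ j, (1 - C ((∏ i, ζ ^ ((θ i : ℕ) * g j i)) * ρ j) * monomial (d j) 1)) ≤
      2 * (2 * (c * N + 1) ^ s) ^ k + 2 := by
  unfold vert
  rw [MultiGradedDesignAux.support_multi_design (by omega) ζ hζ g v ρ hρ d hdis,
    MultiGradedDesignAux.filter_mod_eq_filter_eq g hgc v hv]
  exact multiLevelSetHull_quasi s k N c v hN g hg0 hgc d

/-- **KILL SWITCH at multiplicative rank `s`, registered stub `multiLevelSet_of_T2`.**  If the open stub
`stub_binomialNewtonTauCommon` holds with exponent `b` (sums of `K` scalar multiples of products of `N` binomials over a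
common exponent list have `≤ (KN+2)^b` Newton vertices), then for every dissociated exponent list `d`, vector grades
`g j : Fin s → ℕ` with components `≤ c` and level `v ≤ cN`, the multi-level set `X_v = {Σ_J d : Σ_J g = v}` has at most
`((cN + 1)^s · N + 2)^b` hull vertices: apply T2 to the rank-`s` isolating design with `ρ ≡ 1` and `(cN+1)^s` products
(reindexed by `Fin ((cN+1)^s)`), whose support is exactly `X_v`. [folklore] -/
theorem multiLevelSet_of_T2 (b : ℕ)
    (hT2 : ∀ (K N : ℕ) (c : Fin K → ℂ) (ρ : Fin K → Fin N → ℂ) (d : Fin N → (Fin 2 →₀ ℕ)),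
      vert (∑ l, C (c l) * ∏ j, (1 - C (ρ l j) * monomial (d j) 1)) ≤ (K * N + 2) ^ b)
    (s N c : ℕ) (g : Fin N → Fin s → ℕ) (hgc : ∀ j i, g j i ≤ c) (v : Fin s → ℕ) (hv : ∀ i, v i ≤ c * N)
    (d : Fin N → (Fin 2 →₀ ℕ)) (hdis : ∀ J J' : Finset (Fin N), ∑ j ∈ J, d j = ∑ j ∈ J', d j → J = J') :
    (Set.extremePoints ℝ (convexHull ℝ ((fun e : Fin 2 →₀ ℕ => fun i : Fin 2 => ((e i : ℕ) : ℝ)) ''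
      (((Finset.univ.filter fun J : Finset (Fin N) => ∑ j ∈ J, g j = v).image
        fun J => ∑ j ∈ J, d j : Finset (Fin 2 →₀ ℕ)) : Set (Fin 2 →₀ ℕ))))).ncard ≤
      ((c * N + 1) ^ s * N + 2) ^ b := by
  classical
  -- a primitive `(cN+1)`-th root of unity and the reindexing `Fin ((cN+1)^s) ≃ (Fin s → Fin (cN+1))`
  obtain ⟨ζ, hζ⟩ : ∃ ζ : ℂ, IsPrimitiveRoot ζ (c * N + 1) := ⟨_, Complex.isPrimitiveRoot_exp _ (by omega)⟩
  have hcard : Fintype.card (Fin s → Fin (c * N + 1)) = (c * N + 1) ^ s := by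
    rw [Fintype.card_fun, Fintype.card_fin, Fintype.card_fin]
  obtain ⟨e⟩ : Nonempty (Fin ((c * N + 1) ^ s) ≃ (Fin s → Fin (c * N + 1))) :=
    ⟨(Fintype.equivFinOfCardEq hcard).symm⟩
  -- T2 for the reindexed rank-`s` isolating design with `ρ ≡ 1`
  have key := hT2 ((c * N + 1) ^ s) N
    (fun l => ∏ i, ζ⁻¹ ^ (((e l) i : ℕ) * v i) / ((c * N + 1 : ℕ) : ℂ))
    (fun l j => (∏ i, ζ ^ (((e l) i : ℕ) * g j i)) * 1) d
  rw [Equiv.sum_comp e (fun θ : Fin s → Fin (c * N + 1) =>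
      C (∏ i, ζ⁻¹ ^ ((θ i : ℕ) * v i) / ((c * N + 1 : ℕ) : ℂ)) *
        ∏ j, (1 - C ((∏ i, ζ ^ ((θ i : ℕ) * g j i)) * 1) * monomial (d j) 1))] at key
  unfold vert at key
  rwa [MultiGradedDesignAux.support_multi_design (by omega) ζ hζ g v (fun _ => 1) (fun _ => one_ne_zero) d hdis,
    MultiGradedDesignAux.filter_mod_eq_filter_eq g hgc v hv] at key

end Summit.ValiantsHypothesis.ValiantsHypothesis.Theorems.NewtonUnitEquationsNewtonTauWeak

end
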